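import Summits.CriticalPhenomena.SAWScalingLimit.Theorems.SAWTotalPositivityBoundaryTP2Defs
import Summits.CriticalPhenomena.SAWScalingLimit.Theorems.EdgeOfPositivity.Negative.EdgeOfPositivityRectDomain
import HarnessLib

/-!
# Crux `BoundaryTP2` (stmt-CriticalPhenomena-7115), line `Sketch`: the delicate facing minor on 3-row strips

Tool stub `stub_strip3_certM2` of the line's skeleton (lead c6).  On the 3-row strip
`S_L = {0,…,L} × {0,1,2}` write `a, b, c` for the self-avoiding path kernels from `(0,0)` to
`(L,0), (L,1), (L,2)` and `e` for the kernel `(0,1) → (L,1)`.  The kernel matrix between the two end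
columns is `[[a,b,c],[b,e,b],[c,b,a]]`, and of its `2 × 2` minors exactly one is delicate:
`b² ≥ c·e` (both sides decay like `λ^{2L}` with nearly equal rates).  In the transfer variables
(`S = a + c`, `D = a - c`, the disjoint-pair states `Q, R`, and `B = 2b, e, P` for the start row `1`) it
reads `(S - D)·e ≤ 2b²`, i.e. `S e - 2b² ≤ D e`.

This file proves it for EVERY `L` on the unconditional enclosure `x ∈ [1/3, 5/13]` of `x_c`, as a pure
real statement about sequences obeying the recursion, by a RATE CERTIFICATE:
* the even-sector minors `m₀₁ = Se - bB`, `m₀₂ = SP - QB`, `m₁₂ = bP - Qe` evolve linearly by the second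
  compound of `T_e = [[x+x³,2x²,x⁴],[x²,x,0],[x²,0,x³]]`, with the sign pattern `(+,-,-)` preserved, and the
  positive functional `Θ = m₀₁ - m₀₂/10 - m₁₂/5` contracts: `Θ_{L+1} ≤ μ(x) Θ_L`,
  `μ = x² + x³/5 - 4x⁴/5`;
* the odd sector stays in the cone `0 ≤ R ≤ (7/10) D`, so `D_{L+1} ≥ x(1 - x² - (7/10)x³) D_L`;
* from `L = 2` on, `B ≥ (6/5) e`, so `e_{L+1} ≥ (x + (6/5)x²) e_L`;
* `μ(x) ≤ x(1 - x² - (7/10)x³)·(x + (6/5)x²)` on the enclosure (margin `> 25 %`), so the invariant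
  `Θ_L ≤ D_L e_L` propagates from `L = 2`, where it and `B ≥ (6/5)e` are explicit polynomial
  inequalities; `L = 0, 1` are explicit (`L = 0` is an equality).
All polynomial inequalities on `[1/3, 5/13]` are closed by bounding each monomial at the two endpoints.
Elementary real algebra only; the lead's bridge file instantiates the sequences with the kernels.
-/

noncomputable section

namespace Summit.CriticalPhenomena.SAWScalingLimit.Theorems.BoundaryTP2

open Literature.Probability.LatticeModels Literature.Probability.RandomPlanarGeometry
open Summit.CriticalPhenomena.SAWScalingLimit.Theorems.EdgeOfPositivity.Negative
open scoped ENNReal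

/-- Monomial bounds on the enclosure: `(1/3)^k ≤ x^k ≤ (5/13)^k`. [folklore] -/
private theorem s3m2_pow_bounds {x : ℝ} (hx1 : 1 / 3 ≤ x) (hx2 : x ≤ 5 / 13) (k : ℕ) :
    (1 / 3 : ℝ) ^ k ≤ x ^ k ∧ x ^ k ≤ (5 / 13 : ℝ) ^ k :=
  ⟨pow_le_pow_left₀ (by norm_num) hx1 k, pow_le_pow_left₀ (by linarith) hx2 k⟩

/-- Non-negativity of the six even-sector sequences (the transfer matrix has non-negative entries).
[folklore] -/
private theorem s3m2_nonneg {x : ℝ} (hx0 : 0 ≤ x) (S b Q B e P : ℕ → ℝ)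
    (hS0 : S 0 = 1 + x ^ 2) (hb0 : b 0 = x) (hQ0 : Q 0 = x) (hB0 : B 0 = 2 * x) (he0 : e 0 = 1)
    (hP0 : P 0 = 0)
    (hS : ∀ L, S (L + 1) = (x + x ^ 3) * S L + 2 * x ^ 2 * b L + x ^ 4 * Q L)
    (hb : ∀ L, b (L + 1) = x ^ 2 * S L + x * b L)
    (hQ : ∀ L, Q (L + 1) = x ^ 2 * S L + x ^ 3 * Q L)
    (hB : ∀ L, B (L + 1) = (x + x ^ 3) * B L + 2 * x ^ 2 * e L + x ^ 4 * P L)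
    (he : ∀ L, e (L + 1) = x ^ 2 * B L + x * e L)
    (hP : ∀ L, P (L + 1) = x ^ 2 * B L + x ^ 3 * P L) :
    ∀ L, 0 ≤ S L ∧ 0 ≤ b L ∧ 0 ≤ Q L ∧ 0 ≤ B L ∧ 0 ≤ e L ∧ 0 ≤ P L := by
  have h2 : 0 ≤ x ^ 2 := pow_nonneg hx0 2
  have h3 : 0 ≤ x ^ 3 := pow_nonneg hx0 3
  have h4 : 0 ≤ x ^ 4 := pow_nonneg hx0 4
  intro L
  induction L with
  | zero =>
    rw [hS0, hb0, hQ0, hB0, he0, hP0]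
    exact ⟨by positivity, hx0, hx0, by positivity, zero_le_one, le_rfl⟩
  | succ L ih =>
    obtain ⟨i1, i2, i3, i4, i5, i6⟩ := ih
    rw [hS, hb, hQ, hB, he, hP]
    exact ⟨add_nonneg (add_nonneg (mul_nonneg (add_nonneg hx0 h3) i1)
        (mul_nonneg (mul_nonneg zero_le_two h2) i2)) (mul_nonneg h4 i3),
      add_nonneg (mul_nonneg h2 i1) (mul_nonneg hx0 i2),
      add_nonneg (mul_nonneg h2 i1) (mul_nonneg h3 i3),
      add_nonneg (add_nonneg (mul_nonneg (add_nonneg hx0 h3) i4)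
        (mul_nonneg (mul_nonneg zero_le_two h2) i5)) (mul_nonneg h4 i6),
      add_nonneg (mul_nonneg h2 i4) (mul_nonneg hx0 i5),
      add_nonneg (mul_nonneg h2 i4) (mul_nonneg h3 i6)⟩

/-- The sign pattern `(+,-,-)` of the three even-sector minors, preserved by the second compound of the
transfer matrix for `0 ≤ x ≤ 1`. [folklore] -/
private theorem s3m2_signs {x : ℝ} (hx0 : 0 ≤ x) (hx1 : x ≤ 1) (S b Q B e P : ℕ → ℝ)
    (hS0 : S 0 = 1 + x ^ 2) (hb0 : b 0 = x) (hQ0 : Q 0 = x) (hB0 : B 0 = 2 * x) (he0 : e 0 = 1)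
    (hP0 : P 0 = 0)
    (hS : ∀ L, S (L + 1) = (x + x ^ 3) * S L + 2 * x ^ 2 * b L + x ^ 4 * Q L)
    (hb : ∀ L, b (L + 1) = x ^ 2 * S L + x * b L)
    (hQ : ∀ L, Q (L + 1) = x ^ 2 * S L + x ^ 3 * Q L)
    (hB : ∀ L, B (L + 1) = (x + x ^ 3) * B L + 2 * x ^ 2 * e L + x ^ 4 * P L)
    (he : ∀ L, e (L + 1) = x ^ 2 * B L + x * e L)
    (hP : ∀ L, P (L + 1) = x ^ 2 * B L + x ^ 3 * P L) :
    ∀ L, 0 ≤ S L * e L - b L * B L ∧ S L * P L - Q L * B L ≤ 0 ∧ b L * P L - Q L * e L ≤ 0 := by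
  have hx2 : x ^ 2 ≤ 1 := pow_le_one₀ hx0 hx1
  have hxx : 0 ≤ x ^ 2 - x ^ 4 := by
    have h := mul_le_mul_of_nonneg_left hx2 (pow_nonneg hx0 2)
    nlinarith [h]
  intro L
  induction L with
  | zero =>
    rw [hS0, hb0, hQ0, hB0, he0, hP0]
    refine ⟨by nlinarith [hxx], by nlinarith [pow_nonneg hx0 2], by nlinarith [hx0]⟩
  | succ L ih =>
    obtain ⟨i1, i2, i3⟩ := ih
    have k1 : S (L + 1) * e (L + 1) - b (L + 1) * B (L + 1) =
        (x ^ 2 - x ^ 4) * (S L * e L - b L * B L) - x ^ 6 * (S L * P L - Q L * B L)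
          - x ^ 5 * (b L * P L - Q L * e L) := by
      rw [hS, hb, hB, he]; ring
    have k2 : S (L + 1) * P (L + 1) - Q (L + 1) * B (L + 1) =
        -(2 * x ^ 4) * (S L * e L - b L * B L) + x ^ 4 * (S L * P L - Q L * B L)
          + 2 * x ^ 5 * (b L * P L - Q L * e L) := by
      rw [hS, hP, hQ, hB]; ring
    have k3 : b (L + 1) * P (L + 1) - Q (L + 1) * e (L + 1) =
        -(x ^ 3) * (S L * e L - b L * B L) + x ^ 5 * (S L * P L - Q L * B L)
          + x ^ 4 * (b L * P L - Q L * e L) := by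
      rw [hb, hP, hQ, he]; ring
    have j1 := mul_nonneg hxx i1
    have j2 := mul_nonneg (pow_nonneg hx0 3) i1
    have j3 := mul_nonneg (pow_nonneg hx0 4) i1
    have j4 := mul_nonneg (pow_nonneg hx0 4) (neg_nonneg.2 i2)
    have j5 := mul_nonneg (pow_nonneg hx0 5) (neg_nonneg.2 i2)
    have j6 := mul_nonneg (pow_nonneg hx0 6) (neg_nonneg.2 i2)
    have j7 := mul_nonneg (pow_nonneg hx0 4) (neg_nonneg.2 i3)
    have j8 := mul_nonneg (pow_nonneg hx0 5) (neg_nonneg.2 i3)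
    refine ⟨?_, ?_, ?_⟩
    · rw [k1]; nlinarith [j1, j6, j8]
    · rw [k2]; nlinarith [j3, j4, j8]
    · rw [k3]; nlinarith [j2, j5, j7]

/-- The odd cone `0 ≤ R ≤ (7/10) D` on the enclosure, and the growth `D_{L+1} ≥ ρ_D D_L`,
`ρ_D = x(1 - x² - (7/10)x³)`. [folklore] -/
private theorem s3m2_cone {x : ℝ} (hx1 : 1 / 3 ≤ x) (hx2 : x ≤ 5 / 13) (D R : ℕ → ℝ)
    (hD0 : D 0 = 1 - x ^ 2) (hR0 : R 0 = x)
    (hD : ∀ L, D (L + 1) = x * (1 - x ^ 2) * D L - x ^ 4 * R L)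
    (hR : ∀ L, R (L + 1) = x ^ 2 * D L + x ^ 3 * R L) :
    ∀ L, (0 ≤ D L ∧ 0 ≤ R L ∧ R L ≤ 7 / 10 * D L) ∧
      x * (1 - x ^ 2 - 7 / 10 * x ^ 3) * D L ≤ D (L + 1) := by
  have hx0 : 0 ≤ x := by linarith
  obtain ⟨-, u2⟩ := s3m2_pow_bounds hx1 hx2 2
  obtain ⟨-, u3⟩ := s3m2_pow_bounds hx1 hx2 3
  obtain ⟨-, u4⟩ := s3m2_pow_bounds hx1 hx2 4
  norm_num at u2 u3 u4
  have hcubic : 49 / 100 * x ^ 3 + 7 / 5 * x ^ 2 + x - 7 / 10 ≤ 0 := by linarith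
  have hpos : 0 ≤ 1 - x ^ 2 - 7 / 10 * x ^ 3 := by linarith
  -- one step of the cone, with the growth bound
  have step : ∀ L, 0 ≤ D L → 0 ≤ R L → R L ≤ 7 / 10 * D L →
      (0 ≤ D (L + 1) ∧ 0 ≤ R (L + 1) ∧ R (L + 1) ≤ 7 / 10 * D (L + 1)) ∧
        x * (1 - x ^ 2 - 7 / 10 * x ^ 3) * D L ≤ D (L + 1) := by
    intro L hDL hRL hRD
    have hx4 : 0 ≤ x ^ 4 := pow_nonneg hx0 4
    have hm := mul_le_mul_of_nonneg_left hRD hx4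
    have hgrow : x * (1 - x ^ 2 - 7 / 10 * x ^ 3) * D L ≤ D (L + 1) := by
      have hid : D (L + 1) - x * (1 - x ^ 2 - 7 / 10 * x ^ 3) * D L =
          x ^ 4 * (7 / 10 * D L) - x ^ 4 * R L := by rw [hD]; ring
      linarith [hm, hid]
    have hDn : 0 ≤ D (L + 1) := le_trans (mul_nonneg (mul_nonneg hx0 hpos) hDL) hgrow
    refine ⟨⟨hDn, by rw [hR]; positivity, ?_⟩, hgrow⟩
    have h1 : R L * (x ^ 3 + 7 / 10 * x ^ 4) ≤ 7 / 10 * D L * (x ^ 3 + 7 / 10 * x ^ 4) :=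
      mul_le_mul_of_nonneg_right hRD (by positivity)
    have h2 : D L * (x * (49 / 100 * x ^ 3 + 7 / 5 * x ^ 2 + x - 7 / 10)) ≤ 0 :=
      mul_nonpos_of_nonneg_of_nonpos hDL (mul_nonpos_of_nonneg_of_nonpos hx0 hcubic)
    have hid : 7 / 10 * D (L + 1) - R (L + 1) =
        (7 / 10 * D L * (x ^ 3 + 7 / 10 * x ^ 4) - R L * (x ^ 3 + 7 / 10 * x ^ 4))
          - D L * (x * (49 / 100 * x ^ 3 + 7 / 5 * x ^ 2 + x - 7 / 10)) := by
      rw [hD, hR]; ring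
    linarith [h1, h2, hid]
  intro L
  induction L with
  | zero =>
    have hD00 : 0 ≤ D 0 := by rw [hD0]; linarith
    have hR00 : 0 ≤ R 0 := by rw [hR0]; exact hx0
    have hRD0 : R 0 ≤ 7 / 10 * D 0 := by rw [hR0, hD0]; linarith
    exact ⟨⟨hD00, hR00, hRD0⟩, (step 0 hD00 hR00 hRD0).2⟩
  | succ L ih =>
    obtain ⟨⟨hDL, hRL, hRD⟩, -⟩ := ih
    obtain ⟨h1, -⟩ := step L hDL hRL hRD
    exact ⟨h1, (step (L + 1) h1.1 h1.2.1 h1.2.2).2⟩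

/-- From `L = 2` on the start-row-`1` trajectory satisfies `B ≥ (6/5) e`, hence the growth
`e_{L+1} ≥ (x + (6/5)x²) e_L`. [folklore] -/
private theorem s3m2_ratio {x : ℝ} (hx1 : 1 / 3 ≤ x) (hx2 : x ≤ 5 / 13) (B e P : ℕ → ℝ)
    (hB0 : B 0 = 2 * x) (he0 : e 0 = 1) (hP0 : P 0 = 0)
    (hB : ∀ L, B (L + 1) = (x + x ^ 3) * B L + 2 * x ^ 2 * e L + x ^ 4 * P L)
    (he : ∀ L, e (L + 1) = x ^ 2 * B L + x * e L)
    (hP : ∀ L, P (L + 1) = x ^ 2 * B L + x ^ 3 * P L)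
    (hnn : ∀ L, 0 ≤ B L ∧ 0 ≤ e L ∧ 0 ≤ P L) :
    ∀ L, 2 ≤ L → 6 / 5 * e L ≤ B L ∧ (x + 6 / 5 * x ^ 2) * e L ≤ e (L + 1) := by
  have hx0 : 0 ≤ x := by linarith
  obtain ⟨l1, -⟩ := s3m2_pow_bounds hx1 hx2 1
  obtain ⟨l3, -⟩ := s3m2_pow_bounds hx1 hx2 3
  obtain ⟨-, u4⟩ := s3m2_pow_bounds hx1 hx2 4
  obtain ⟨l5, -⟩ := s3m2_pow_bounds hx1 hx2 5
  norm_num at l1 l3 u4 l5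
  have hB1 : B 1 = 4 * x ^ 2 + 2 * x ^ 4 := by rw [hB 0, hB0, he0, hP0]; ring
  have he1 : e 1 = x + 2 * x ^ 3 := by rw [he 0, hB0, he0]; ring
  have hP1 : P 1 = 2 * x ^ 3 := by rw [hP 0, hB0, hP0]; ring
  have hB2 : B 2 = 6 * x ^ 3 + 10 * x ^ 5 + 4 * x ^ 7 := by rw [hB 1, hB1, he1, hP1]; ring
  have he2 : e 2 = x ^ 2 + 6 * x ^ 4 + 2 * x ^ 6 := by rw [he 1, hB1, he1]; ring
  -- growth from the ratio
  have grow : ∀ L, 6 / 5 * e L ≤ B L → (x + 6 / 5 * x ^ 2) * e L ≤ e (L + 1) := by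
    intro L h
    have t := mul_le_mul_of_nonneg_left h (pow_nonneg hx0 2)
    have hid : e (L + 1) - (x + 6 / 5 * x ^ 2) * e L = x ^ 2 * B L - x ^ 2 * (6 / 5 * e L) := by
      rw [he]; ring
    linarith [t, hid]
  -- base `L = 2`: `B₂ - (6/5)e₂ = x² f`, `f = -6/5 + 6x - (36/5)x² + 10x³ - (12/5)x⁴ + 4x⁵ > 0`
  have hbase : 6 / 5 * e 2 ≤ B 2 := by
    have hlin : 36 / 5 * x ^ 2 ≤ 36 / 13 * x := by nlinarith
    have hf : 0 ≤ -6 / 5 + 6 * x - 36 / 5 * x ^ 2 + 10 * x ^ 3 - 12 / 5 * x ^ 4 + 4 * x ^ 5 := by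
      linarith
    have t := mul_nonneg (pow_nonneg hx0 2) hf
    have hid : B 2 - 6 / 5 * e 2 =
        x ^ 2 * (-6 / 5 + 6 * x - 36 / 5 * x ^ 2 + 10 * x ^ 3 - 12 / 5 * x ^ 4 + 4 * x ^ 5) := by
      rw [hB2, he2]; ring
    linarith [t, hid]
  have hratio : ∀ L, 2 ≤ L → 6 / 5 * e L ≤ B L := by
    refine Nat.le_induction hbase (fun L _ ihL => ?_)
    obtain ⟨-, heL, hPL⟩ := hnn L
    have hc : 0 ≤ x + x ^ 3 - 6 / 5 * x ^ 2 := by nlinarith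
    have t1 := mul_le_mul_of_nonneg_left ihL hc
    have t2 := mul_nonneg (pow_nonneg hx0 4) hPL
    have t3 := mul_nonneg (mul_nonneg (pow_nonneg hx0 2)
      (by linarith : (0 : ℝ) ≤ 6 / 5 * x + 14 / 25)) heL
    have hid : B (L + 1) - 6 / 5 * e (L + 1) =
        ((x + x ^ 3 - 6 / 5 * x ^ 2) * B L - (x + x ^ 3 - 6 / 5 * x ^ 2) * (6 / 5 * e L))
          + x ^ 4 * P L + x ^ 2 * (6 / 5 * x + 14 / 25) * e L := by
      rw [hB, he]; ring
    linarith [t1, t2, t3, hid]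
  exact fun L hL => ⟨hratio L hL, grow L (hratio L hL)⟩

/-- **Tool stub `stub_strip3_certM2`** (the delicate facing minor `b² ≥ ce` on every 3-row strip, as a
rate certificate on the transfer sequences; see the module docstring). For `x ∈ [1/3, 5/13]` and real
sequences obeying the even recursion (`S,b,Q` from `(1+x²,x,x)`, `B,e,P` from `(2x,1,0)`), the odd
recursion (`D,R` from `(1-x²,x)`) and `B = 2b`: `(S_L - D_L) e_L ≤ 2 b_L²` for every `L`. [folklore] -/
theorem stub_strip3_certM2 {x : ℝ} (hx1 : 1 / 3 ≤ x) (hx2 : x ≤ 5 / 13) (S b Q B e P D R : ℕ → ℝ)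
    (hS0 : S 0 = 1 + x ^ 2) (hb0 : b 0 = x) (hQ0 : Q 0 = x) (hB0 : B 0 = 2 * x) (he0 : e 0 = 1)
    (hP0 : P 0 = 0) (hD0 : D 0 = 1 - x ^ 2) (hR0 : R 0 = x)
    (hS : ∀ L, S (L + 1) = (x + x ^ 3) * S L + 2 * x ^ 2 * b L + x ^ 4 * Q L)
    (hb : ∀ L, b (L + 1) = x ^ 2 * S L + x * b L)
    (hQ : ∀ L, Q (L + 1) = x ^ 2 * S L + x ^ 3 * Q L)
    (hB : ∀ L, B (L + 1) = (x + x ^ 3) * B L + 2 * x ^ 2 * e L + x ^ 4 * P L)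
    (he : ∀ L, e (L + 1) = x ^ 2 * B L + x * e L)
    (hP : ∀ L, P (L + 1) = x ^ 2 * B L + x ^ 3 * P L)
    (hD : ∀ L, D (L + 1) = x * (1 - x ^ 2) * D L - x ^ 4 * R L)
    (hR : ∀ L, R (L + 1) = x ^ 2 * D L + x ^ 3 * R L)
    (hsym : ∀ L, B L = 2 * b L) :
    ∀ L, (S L - D L) * e L ≤ 2 * b L ^ 2 := by
  have hx0 : 0 ≤ x := by linarith
  obtain ⟨l1, u1⟩ := s3m2_pow_bounds hx1 hx2 1
  obtain ⟨l2, u2⟩ := s3m2_pow_bounds hx1 hx2 2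
  obtain ⟨l3, u3⟩ := s3m2_pow_bounds hx1 hx2 3
  obtain ⟨l4, u4⟩ := s3m2_pow_bounds hx1 hx2 4
  obtain ⟨l5, u5⟩ := s3m2_pow_bounds hx1 hx2 5
  obtain ⟨l6, u6⟩ := s3m2_pow_bounds hx1 hx2 6
  obtain ⟨l7, u7⟩ := s3m2_pow_bounds hx1 hx2 7
  norm_num at l1 u1 l2 u2 l3 u3 l4 u4
  norm_num at l5 u5 l6 u6 l7 u7
  have hnn := s3m2_nonneg hx0 S b Q B e P hS0 hb0 hQ0 hB0 he0 hP0 hS hb hQ hB he hP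
  have hsg := s3m2_signs hx0 (by linarith) S b Q B e P hS0 hb0 hQ0 hB0 he0 hP0 hS hb hQ hB he hP
  have hcone := s3m2_cone hx1 hx2 D R hD0 hR0 hD hR
  have hrat := s3m2_ratio hx1 hx2 B e P hB0 he0 hP0 hB he hP (fun L => (hnn L).2.2.2)
  -- explicit values at `L = 1, 2`
  have hS1 : S 1 = x + 4 * x ^ 3 + 2 * x ^ 5 := by rw [hS 0, hS0, hb0, hQ0]; ring
  have hb1 : b 1 = 2 * x ^ 2 + x ^ 4 := by rw [hb 0, hS0, hb0]; ring
  have hQ1 : Q 1 = x ^ 2 + 2 * x ^ 4 := by rw [hQ 0, hS0, hQ0]; ring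
  have hB1 : B 1 = 4 * x ^ 2 + 2 * x ^ 4 := by rw [hB 0, hB0, he0, hP0]; ring
  have he1 : e 1 = x + 2 * x ^ 3 := by rw [he 0, hB0, he0]; ring
  have hP1 : P 1 = 2 * x ^ 3 := by rw [hP 0, hB0, hP0]; ring
  have hD1 : D 1 = x - 2 * x ^ 3 := by rw [hD 0, hD0, hR0]; ring
  have hR1 : R 1 = x ^ 2 := by rw [hR 0, hD0, hR0]; ring
  have hS2 : S 2 = x ^ 2 + 9 * x ^ 4 + 9 * x ^ 6 + 4 * x ^ 8 := by rw [hS 1, hS1, hb1, hQ1]; ring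
  have hb2 : b 2 = 3 * x ^ 3 + 5 * x ^ 5 + 2 * x ^ 7 := by rw [hb 1, hS1, hb1]; ring
  have hQ2 : Q 2 = x ^ 3 + 5 * x ^ 5 + 4 * x ^ 7 := by rw [hQ 1, hS1, hQ1]; ring
  have hB2 : B 2 = 6 * x ^ 3 + 10 * x ^ 5 + 4 * x ^ 7 := by rw [hB 1, hB1, he1, hP1]; ring
  have he2 : e 2 = x ^ 2 + 6 * x ^ 4 + 2 * x ^ 6 := by rw [he 1, hB1, he1]; ring
  have hP2 : P 2 = 4 * x ^ 4 + 4 * x ^ 6 := by rw [hP 1, hB1, hP1]; ring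
  have hD2 : D 2 = x ^ 2 - 3 * x ^ 4 + x ^ 6 := by rw [hD 1, hD1, hR1]; ring
  -- the rate inequality `μ ≤ ρ_D ρ_e` (difference `= x³ (1 - x/5 - (19/10)x² - (21/25)x³)`)
  have hrate : x ^ 2 + x ^ 3 / 5 - 4 / 5 * x ^ 4 ≤
      (x * (1 - x ^ 2 - 7 / 10 * x ^ 3)) * (x + 6 / 5 * x ^ 2) := by
    have t := mul_nonneg (pow_nonneg hx0 3)
      (by linarith : (0 : ℝ) ≤ 1 - x / 5 - 19 / 10 * x ^ 2 - 21 / 25 * x ^ 3)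
    have hid : (x * (1 - x ^ 2 - 7 / 10 * x ^ 3)) * (x + 6 / 5 * x ^ 2) - (x ^ 2 + x ^ 3 / 5 - 4 / 5 * x ^ 4)
        = x ^ 3 * (1 - x / 5 - 19 / 10 * x ^ 2 - 21 / 25 * x ^ 3) := by ring
    linarith [t, hid]
  have hc1 : x ^ 6 + x ^ 4 / 10 + x ^ 5 / 5 ≤ (x ^ 2 + x ^ 3 / 5 - 4 / 5 * x ^ 4) / 10 := by linarith
  have hc2 : 6 / 5 * x ^ 5 + x ^ 4 / 5 ≤ (x ^ 2 + x ^ 3 / 5 - 4 / 5 * x ^ 4) / 5 := by linarith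
  have hμ0 : 0 ≤ x ^ 2 + x ^ 3 / 5 - 4 / 5 * x ^ 4 := by linarith
  -- the invariant `Θ_L ≤ D_L e_L` from `L = 2`
  have hinv : ∀ L, 2 ≤ L →
      (S L * e L - b L * B L) - (S L * P L - Q L * B L) / 10 - (b L * P L - Q L * e L) / 5 ≤
        D L * e L := by
    have hbase : (S 2 * e 2 - b 2 * B 2) - (S 2 * P 2 - Q 2 * B 2) / 10 - (b 2 * P 2 - Q 2 * e 2) / 5 ≤
        D 2 * e 2 := by
      have hg : 0 ≤ -1 / 5 + 29 / 5 * x + x ^ 2 / 5 - 20 * x ^ 3 - 4 / 5 * x ^ 4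
          - 13 / 5 * x ^ 5 - 6 / 5 * x ^ 6 - 4 / 5 * x ^ 7 := by
        linarith
      have t := mul_nonneg (pow_nonneg hx0 5) hg
      have hid : D 2 * e 2 - ((S 2 * e 2 - b 2 * B 2) - (S 2 * P 2 - Q 2 * B 2) / 10
          - (b 2 * P 2 - Q 2 * e 2) / 5) = x ^ 5 * (-1 / 5 + 29 / 5 * x + x ^ 2 / 5 - 20 * x ^ 3
            - 4 / 5 * x ^ 4 - 13 / 5 * x ^ 5 - 6 / 5 * x ^ 6 - 4 / 5 * x ^ 7) := by
        rw [hS2, hb2, hQ2, hB2, he2, hP2, hD2]; ring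
      linarith [t, hid]
    refine Nat.le_induction hbase (fun L hL2 ihL => ?_)
    obtain ⟨-, i2, i3⟩ := hsg L
    obtain ⟨⟨hDL, -, -⟩, hDgrow⟩ := hcone L
    obtain ⟨-, -, -, -, heL, -⟩ := hnn L
    obtain ⟨-, hegrow⟩ := hrat L hL2
    -- the new functional in terms of the old minors (second compound of `T_e`)
    have key : (S (L + 1) * e (L + 1) - b (L + 1) * B (L + 1))
        - (S (L + 1) * P (L + 1) - Q (L + 1) * B (L + 1)) / 10
        - (b (L + 1) * P (L + 1) - Q (L + 1) * e (L + 1)) / 5 =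
        (x ^ 2 + x ^ 3 / 5 - 4 / 5 * x ^ 4) * (S L * e L - b L * B L)
          + (x ^ 6 + x ^ 4 / 10 + x ^ 5 / 5) * (-(S L * P L - Q L * B L))
          + (6 / 5 * x ^ 5 + x ^ 4 / 5) * (-(b L * P L - Q L * e L)) := by
      rw [hS, hb, hQ, hB, he, hP]; ring
    rw [key]
    -- contraction `≤ μ Θ_L`, then `μ Θ_L ≤ μ D_L e_L ≤ ρ_D ρ_e D_L e_L ≤ D_{L+1} e_{L+1}`
    have s1 := mul_le_mul_of_nonneg_right hc1 (neg_nonneg.2 i2)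
    have s2 := mul_le_mul_of_nonneg_right hc2 (neg_nonneg.2 i3)
    have hDe : 0 ≤ D L * e L := mul_nonneg hDL heL
    have s3 := mul_le_mul_of_nonneg_left ihL hμ0
    have s4 := mul_le_mul_of_nonneg_right hrate hDe
    have hρD : 0 ≤ x * (1 - x ^ 2 - 7 / 10 * x ^ 3) * D L :=
      mul_nonneg (mul_nonneg hx0 (by linarith)) hDL
    have hρe : 0 ≤ (x + 6 / 5 * x ^ 2) * e L := mul_nonneg (by positivity) heL
    have s5 : (x * (1 - x ^ 2 - 7 / 10 * x ^ 3) * D L) * ((x + 6 / 5 * x ^ 2) * e L) ≤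
        D (L + 1) * e (L + 1) :=
      mul_le_mul hDgrow hegrow hρe (le_trans hρD hDgrow)
    have hid1 : (x ^ 2 + x ^ 3 / 5 - 4 / 5 * x ^ 4) *
          ((S L * e L - b L * B L) - (S L * P L - Q L * B L) / 10 - (b L * P L - Q L * e L) / 5) =
        (x ^ 2 + x ^ 3 / 5 - 4 / 5 * x ^ 4) * (S L * e L - b L * B L)
          + (x ^ 2 + x ^ 3 / 5 - 4 / 5 * x ^ 4) / 10 * (-(S L * P L - Q L * B L))
          + (x ^ 2 + x ^ 3 / 5 - 4 / 5 * x ^ 4) / 5 * (-(b L * P L - Q L * e L)) := by ring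
    have hid2 : (x * (1 - x ^ 2 - 7 / 10 * x ^ 3) * D L) * ((x + 6 / 5 * x ^ 2) * e L) =
        (x * (1 - x ^ 2 - 7 / 10 * x ^ 3)) * (x + 6 / 5 * x ^ 2) * (D L * e L) := by ring
    linarith [s1, s2, s3, s4, s5, hid1, hid2]
  -- conclusion
  intro L
  rcases L with _ | _ | L
  · rw [hS0, hD0, he0, hb0]
    have hid : 2 * x ^ 2 - (1 + x ^ 2 - (1 - x ^ 2)) * 1 = 0 := by ring
    linarith [hid]
  · rw [hS1, hD1, he1, hb1]
    have t := mul_nonneg (pow_nonneg hx0 4) (by linarith : (0 : ℝ) ≤ 1 - 3 * x ^ 2 - x ^ 4)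
    have hid : 2 * (2 * x ^ 2 + x ^ 4) ^ 2 - (x + 4 * x ^ 3 + 2 * x ^ 5 - (x - 2 * x ^ 3)) * (x + 2 * x ^ 3)
        = 2 * (x ^ 4 * (1 - 3 * x ^ 2 - x ^ 4)) := by ring
    linarith [t, hid]
  · have hL : 2 ≤ L + 1 + 1 := by omega
    have h1 := hinv (L + 1 + 1) hL
    obtain ⟨-, i2, i3⟩ := hsg (L + 1 + 1)
    have hb2' : b (L + 1 + 1) * B (L + 1 + 1) = 2 * b (L + 1 + 1) ^ 2 := by
      rw [hsym (L + 1 + 1)]; ring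
    have hid : (S (L + 1 + 1) - D (L + 1 + 1)) * e (L + 1 + 1) =
        S (L + 1 + 1) * e (L + 1 + 1) - D (L + 1 + 1) * e (L + 1 + 1) := by ring
    linarith [h1, i2, i3, hb2', hid]

end Summit.CriticalPhenomena.SAWScalingLimit.Theorems.BoundaryTP2
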